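import Summits.QuantumFields.YangMills.Theorems.UnitScaleTiltProp7FirstVariationCurrent
import HarnessLib

/-!
# Route `UnitScaleTilt`, crux K1 child «MinimiserStabilityRegPr» (stmt-QuantumFields-19200) — «blend-ℓ²» line (OWNER RULING g24-№1 §B), stub S4
# `firstVariationFibre`, sub-lemmas S4a ∕ S4b: **THE FIRST VARIATION SEES ONLY THE 𝔲(2)-PART OF THE REPRESENTATIVE UP TO `(ε₀/2)·L^{−3(K−n)}·Σ‖Y‖²`**

Cell `ym3-torus` ∕ width seat `ym-ust-19200-w1` (gen 0; HUMAN RULING D-0037 — YM₃ on T³ is ladder rung R3, not the Clay problem).  WHY.  S4 (CARD-19200-V3-g9 §5,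
schema (iii) of `Prop7BlendClause1.atMostOneCriticalOrbit_of_reprSchema_T3`) asks `Lin_U(Y) ≥ −C_L·Σ_b‖Y_b‖²` for `Y_b = W′_bU_b* − 1`, `U` R2-critical.
`Lin_U` is the pairing with the current `J = D^{1*}_U∂U` (`Prop7FirstVariationCurrent.lin_eq_neg_half_sum_re_trace_mul_covDivT`), `‖J_b‖ < ε₀L^{−3(K−n)}` on
print's regular space (the divergence clause of (2) ∕ (6)); since `1 + Y_b = W′_bU_b*` is unitary, the Hermitian part of `Y_b` is `½(Y_b + Y_b*) = −½Y_bY_b*`,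
QUADRATIC in `Y`.  So `Lin_U(Y)` and `Lin_U` of the skew part `A_b = ½(Y_b − Y_b*)` (the 𝔲(2)-direction along which R2-minimality will be used, S4c–S4f)
differ by at most `(ε₀/2)L^{−3(K−n)}Σ_b‖Y_b‖²` — an admissible piece of `C_L` (`C_L = O(ε₀L^{−2(K−n)})`).

WHAT IS PROVED (sorry-free, no definition).  `add_star_eq_neg_mul_star` (`Y + Y* = −YY*` when `(1+Y)(1+Y)* = 1`), `norm_add_star_le_sq`,
`norm_sub_skew_le` (`‖Y − ½(Y − Y*)‖ ≤ ½‖Y‖²`); **`abs_lin_sub_lin_skew_le_T3`**: for `U` with `DivSmall F n K ε₀ U` and `Y` with `1 + Y_b` unitary at every bond,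
`|Lin_U(Y) − Lin_U(A)| ≤ (ε₀/2)·(L^{K−n})⁻³·Σ_b‖Y_b‖²` for `A = ½(Y − Y*)` (both `Lin`'s in the schema's displayed plaquette form).

HONEST SCOPE.  Elementary matrix algebra on the tree's current identity; S4's content (R2-minimality along the corrected fibre path, the tree right-inverse
and the second-order remainder of the `k`-fold average — S4c–S4f) is NOT here.  Count-neutral helper toward stmt-QuantumFields-19200 (`--supports`); nothing
continuum ∕ OS ∕ mass-gap ∕ Clay.

References: T. Bałaban, CMP **99** (1985) 389–434 [Balaban1985BackgroundPropagators] ((3.9), (3.11) p.392); CMP **102** (1985) 277–309 [Balaban1985Variational]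
((2), (6) p.278, (141)–(143) p.299); CMP **98** (1985) 17–51 [Balaban1985Averaging] ((19)–(20) p.21).
-/

noncomputable section

open scoped BigOperators Matrix.Norms.L2Operator Matrix

namespace Summit.QuantumFields.YangMills.Theorems.Prop7FirstVariationHerm

open Literature.MathematicalPhysics.QuantumFieldTheory.Balaban1983to89
open B10Eq27TorusAxialLog (unitsField toUField)
open B10Eq68TorusRegularity (covDivT)
open Summit.QuantumFields.YangMills.Theorems.Prop7CovariantCoercivity (abs_re_trace_le)
open Summit.QuantumFields.YangMills.Theorems.Prop7FirstVariationCurrent (lin_eq_neg_half_sum_re_trace_mul_covDivT)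

/-! ## §1 The Hermitian part of `Y` is quadratic when `1 + Y` is unitary -/

section Algebra

variable {N : ℕ}

/-- **`Y + Y* = −YY*` when `(1 + Y)(1 + Y)* = 1`** (`W′U* = 1 + Y` unitary): the Hermitian part of the representative is quadratic.
[cite: Balaban1985Averaging, (19)–(20) p.21] -/
theorem add_star_eq_neg_mul_star (Y : Matrix (Fin N) (Fin N) ℂ) (h : (1 + Y) * star (1 + Y) = 1) :
    Y + star Y = -(Y * star Y) := by
  have e : (1 + Y) * star (1 + Y) = 1 + (Y + star Y + Y * star Y) := by
    rw [star_add, star_one]; noncomm_ring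
  rw [e, add_eq_left] at h
  rw [eq_neg_iff_add_eq_zero, h]

/-- `‖Y + Y*‖ ≤ ‖Y‖²` when `1 + Y` is unitary. [cite: Balaban1985Averaging, (19)–(20) p.21] -/
theorem norm_add_star_le_sq (Y : Matrix (Fin N) (Fin N) ℂ) (h : (1 + Y) * star (1 + Y) = 1) : ‖Y + star Y‖ ≤ ‖Y‖ ^ 2 := by
  rw [add_star_eq_neg_mul_star Y h, norm_neg, sq]
  exact (norm_mul_le _ _).trans (by rw [norm_star])

/-- `‖Y − ½(Y − Y*)‖ = ‖½(Y + Y*)‖ ≤ ½‖Y‖²` when `1 + Y` is unitary. [cite: Balaban1985Averaging, (19)–(20) p.21] -/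
theorem norm_sub_skew_le (Y : Matrix (Fin N) (Fin N) ℂ) (h : (1 + Y) * star (1 + Y) = 1) :
    ‖Y - (1 / 2 : ℂ) • (Y - star Y)‖ ≤ (1 / 2) * ‖Y‖ ^ 2 := by
  have he : Y - (1 / 2 : ℂ) • (Y - star Y) = (1 / 2 : ℂ) • (Y + star Y) := by
    rw [smul_sub, smul_add]; module
  rw [he, norm_smul]
  have h2 : ‖(1 / 2 : ℂ)‖ = 1 / 2 := by simp
  rw [h2]
  exact mul_le_mul_of_nonneg_left (norm_add_star_le_sq Y h) (by norm_num)

end Algebra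

/-! ## §2 At the d = 3 carrier: the first variation of `Y` and of its skew part differ by `O(ε₀L^{−3k})·Σ‖Y‖²` -/

section Carrier

open T3ContinuumYM3Torus T3PrintedRegularMinimiser

/-- **S4a ∕ S4b: `|Lin_U(Y) − Lin_U(½(Y − Y*))| ≤ (ε₀/2)·(L^{K−n})⁻³·Σ_b‖Y_b‖²`** for `U` with the divergence clause `DivSmall F n K ε₀ U` of print's regular
space and a bond field `Y` with `1 + Y_b` unitary at every bond (`Y_b = W′_bU_b* − 1`).  Both first variations in the displayed plaquette form of the schema
`Prop7BlendClause1.atMostOneCriticalOrbit_of_reprSchema_T3` (iii); by the current identity both are `−½Σ_b Re Tr(·J_b)`, the difference is the pairing of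
`J` with the Hermitian part `½(Y + Y*) = −½YY*`, and `|Re Tr(MJ_b)| ≤ 2‖M‖‖J_b‖`, `‖J_b‖ < ε₀L^{−3(K−n)}`.
[cite: Balaban1985BackgroundPropagators, (3.11) p.392; Balaban1985Variational, (2), (6) p.278] -/
theorem abs_lin_sub_lin_skew_le_T3 (F : T3Family) (n K : ℕ) {ε₀ : ℝ} (U : GaugeField (F.P K) 0 (Matrix.specialUnitaryGroup (Fin 2) ℂ))
    (hU : DivSmall F n K ε₀ U) (Y A : PBond (F.P K) 0 → Matrix (Fin 2) (Fin 2) ℂ)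
    (hY : ∀ b : PBond (F.P K) 0, (1 + Y b) * star (1 + Y b) = 1) (hA : ∀ b : PBond (F.P K) 0, A b = (1 / 2 : ℂ) • (Y b - star (Y b))) :
    |(∑ p : Plaq (F.P K) 0, (1 / 2) * ((((((GaugeField.plaqHol U p : Matrix.specialUnitaryGroup (Fin 2) ℂ) : Matrix (Fin 2) (Fin 2) ℂ)) - 1)ᴴ
          * ((Y ⟨p.src, p.μ⟩
              + (U ⟨p.src, p.μ⟩ : Matrix (Fin 2) (Fin 2) ℂ) * Y ⟨p.src.shift p.μ, p.ν⟩ * star (U ⟨p.src, p.μ⟩ : Matrix (Fin 2) (Fin 2) ℂ)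
              - ((U ⟨p.src, p.μ⟩ * U ⟨p.src.shift p.μ, p.ν⟩ * (U ⟨p.src.shift p.ν, p.μ⟩)⁻¹ : Matrix.specialUnitaryGroup (Fin 2) ℂ) : Matrix (Fin 2) (Fin 2) ℂ)
                  * Y ⟨p.src.shift p.ν, p.μ⟩
                  * star ((U ⟨p.src, p.μ⟩ * U ⟨p.src.shift p.μ, p.ν⟩ * (U ⟨p.src.shift p.ν, p.μ⟩)⁻¹ : Matrix.specialUnitaryGroup (Fin 2) ℂ) : Matrix (Fin 2) (Fin 2) ℂ)
              - ((GaugeField.plaqHol U p : Matrix.specialUnitaryGroup (Fin 2) ℂ) : Matrix (Fin 2) (Fin 2) ℂ) * Y ⟨p.src, p.ν⟩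
                  * star ((GaugeField.plaqHol U p : Matrix.specialUnitaryGroup (Fin 2) ℂ) : Matrix (Fin 2) (Fin 2) ℂ))
            * ((GaugeField.plaqHol U p : Matrix.specialUnitaryGroup (Fin 2) ℂ) : Matrix (Fin 2) (Fin 2) ℂ))).trace).re)
      - (∑ p : Plaq (F.P K) 0, (1 / 2) * ((((((GaugeField.plaqHol U p : Matrix.specialUnitaryGroup (Fin 2) ℂ) : Matrix (Fin 2) (Fin 2) ℂ)) - 1)ᴴ
          * ((A ⟨p.src, p.μ⟩
              + (U ⟨p.src, p.μ⟩ : Matrix (Fin 2) (Fin 2) ℂ) * A ⟨p.src.shift p.μ, p.ν⟩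
                  * star (U ⟨p.src, p.μ⟩ : Matrix (Fin 2) (Fin 2) ℂ)
              - ((U ⟨p.src, p.μ⟩ * U ⟨p.src.shift p.μ, p.ν⟩ * (U ⟨p.src.shift p.ν, p.μ⟩)⁻¹ : Matrix.specialUnitaryGroup (Fin 2) ℂ) : Matrix (Fin 2) (Fin 2) ℂ)
                  * A ⟨p.src.shift p.ν, p.μ⟩
                  * star ((U ⟨p.src, p.μ⟩ * U ⟨p.src.shift p.μ, p.ν⟩ * (U ⟨p.src.shift p.ν, p.μ⟩)⁻¹ : Matrix.specialUnitaryGroup (Fin 2) ℂ) : Matrix (Fin 2) (Fin 2) ℂ)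
              - ((GaugeField.plaqHol U p : Matrix.specialUnitaryGroup (Fin 2) ℂ) : Matrix (Fin 2) (Fin 2) ℂ)
                  * A ⟨p.src, p.ν⟩
                  * star ((GaugeField.plaqHol U p : Matrix.specialUnitaryGroup (Fin 2) ℂ) : Matrix (Fin 2) (Fin 2) ℂ))
            * ((GaugeField.plaqHol U p : Matrix.specialUnitaryGroup (Fin 2) ℂ) : Matrix (Fin 2) (Fin 2) ℂ))).trace).re)|
      ≤ (ε₀ / 2) * (((F.L : ℝ) ^ (K - n)) ^ 3)⁻¹ * ∑ b : PBond (F.P K) 0, ‖Y b‖ ^ 2 := by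
  rw [lin_eq_neg_half_sum_re_trace_mul_covDivT, lin_eq_neg_half_sum_re_trace_mul_covDivT, ← mul_sub, ← Finset.sum_sub_distrib]
  -- the difference pairs `J` with the Hermitian part `Y − A = ½(Y + Y*)`
  have hsub : ∀ b : PBond (F.P K) 0,
      ((Y b * covDivT 1 (unitsField (toUField U)) b.dir b.src).trace).re
        - ((A b * covDivT 1 (unitsField (toUField U)) b.dir b.src).trace).re
        = (((Y b - (1 / 2 : ℂ) • (Y b - star (Y b))) * covDivT 1 (unitsField (toUField U)) b.dir b.src).trace).re := by
    intro b
    rw [hA b, Matrix.sub_mul, Matrix.trace_sub, Complex.sub_re]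
  simp only [hsub]
  have hpow : ((F.L : ℝ)⁻¹) ^ (3 * (K - n)) = (((F.L : ℝ) ^ (K - n)) ^ 3)⁻¹ := by rw [inv_pow, mul_comm, pow_mul]
  -- bondwise: `|Re Tr(HJ)| ≤ 2‖H‖‖J‖ ≤ 2·½‖Y‖²·ε₀L^{−3k}`
  have hb : ∀ b : PBond (F.P K) 0,
      |(((Y b - (1 / 2 : ℂ) • (Y b - star (Y b))) * covDivT 1 (unitsField (toUField U)) b.dir b.src).trace).re|
        ≤ ‖Y b‖ ^ 2 * (ε₀ * (((F.L : ℝ) ^ (K - n)) ^ 3)⁻¹) := by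
    intro b
    have h1 := abs_re_trace_le ((Y b - (1 / 2 : ℂ) • (Y b - star (Y b))) * covDivT 1 (unitsField (toUField U)) b.dir b.src)
    have hJ : ‖covDivT 1 (unitsField (toUField U)) b.dir b.src‖ ≤ ε₀ * (((F.L : ℝ) ^ (K - n)) ^ 3)⁻¹ := by rw [← hpow]; exact (hU b).le
    have hH := norm_sub_skew_le (Y b) (hY b)
    calc |(((Y b - (1 / 2 : ℂ) • (Y b - star (Y b))) * covDivT 1 (unitsField (toUField U)) b.dir b.src).trace).re|
        ≤ 2 * ‖(Y b - (1 / 2 : ℂ) • (Y b - star (Y b))) * covDivT 1 (unitsField (toUField U)) b.dir b.src‖ := by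
          simpa using h1
      _ ≤ 2 * (((1 / 2) * ‖Y b‖ ^ 2) * (ε₀ * (((F.L : ℝ) ^ (K - n)) ^ 3)⁻¹)) :=
          mul_le_mul_of_nonneg_left ((norm_mul_le _ _).trans (mul_le_mul hH hJ (norm_nonneg _) (by positivity))) (by norm_num)
      _ = ‖Y b‖ ^ 2 * (ε₀ * (((F.L : ℝ) ^ (K - n)) ^ 3)⁻¹) := by ring
  rw [abs_mul, abs_neg, abs_of_pos (by norm_num : (0 : ℝ) < 1 / 2)]
  calc (1 / 2) * |∑ b : PBond (F.P K) 0, (((Y b - (1 / 2 : ℂ) • (Y b - star (Y b))) * covDivT 1 (unitsField (toUField U)) b.dir b.src).trace).re|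
      ≤ (1 / 2) * ∑ b : PBond (F.P K) 0, ‖Y b‖ ^ 2 * (ε₀ * (((F.L : ℝ) ^ (K - n)) ^ 3)⁻¹) :=
        mul_le_mul_of_nonneg_left ((Finset.abs_sum_le_sum_abs _ _).trans (Finset.sum_le_sum fun b _ => hb b)) (by norm_num)
    _ = (ε₀ / 2) * (((F.L : ℝ) ^ (K - n)) ^ 3)⁻¹ * ∑ b : PBond (F.P K) 0, ‖Y b‖ ^ 2 := by
        rw [← Finset.sum_mul]; ring

end Carrier

end Summit.QuantumFields.YangMills.Theorems.Prop7FirstVariationHerm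

end
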